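import Summits.Ventures.PercRepro.PassScheme

/-!
# Tree passes are canonical: an injective pass serves exactly `{x : f x ∈ cell ∖ claimed}` (p5, gen 7)

For a pass whose candidate list is the single image `f x` when it lies in the designated `cell`
(`treeCand f cell`), with `f` INJECTIVE (mine-3's «every sealing tree is a bijection of the cube, so a
pass never collides with itself»), the set of sources served by the pass does not depend on the order
in which the sources are processed: starting from a state `st₀`, a source `x` of the pass is served
afterwards iff it was served before, or `f x ∈ cell` and `f x` was not claimed before the pass
(**`mem_fst_foldl_treeRequests_iff`**).  Hence mine-3's claims C1–C5 («pass k serves `S` iff the k-th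
swap lands in its cell and the target is free») are exact descriptions of the served sets, and the run
of a scheme of injective tree passes is decodable by replay.
-/

namespace PercRepro

namespace PassScheme

variable {α : Type*} [DecidableEq α]

/-- The candidate list of a tree pass: the image when it lies in the cell, nothing otherwise. -/
def treeCand (f : α → α) (cell : α → Prop) [DecidablePred cell] (x : α) : List α :=
  if cell (f x) then [f x] else []

/-- The requests of one tree pass over the sources `xs`, in order. -/
def treeRequests (f : α → α) (cell : α → Prop) [DecidablePred cell] (xs : List α) :
    List (α × List α) :=
  xs.map fun x => (x, treeCand f cell x)

omit [DecidableEq α] in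
/-- Membership in a tree-pass candidate list. -/
theorem mem_treeCand {f : α → α} {cell : α → Prop} [DecidablePred cell] {x t : α} :
    t ∈ treeCand f cell x ↔ t = f x ∧ cell (f x) := by
  unfold treeCand
  split_ifs with h
  · simp [h]
  · simp [h]

/-- **The invariant of a tree pass** relative to the state `st₀` it started from: served sources and
claimed targets only grow; every claimed target is an old one or the image of a source served
meanwhile; every source served meanwhile has its image in the cell and unclaimed before the pass. -/
structure TreeInv (f : α → α) (cell : α → Prop) (st₀ st : List (α × α)) : Prop where
  /-- served sources only grow -/
  sub_fst : ∀ y ∈ st₀.map Prod.fst, y ∈ st.map Prod.fst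
  /-- claimed targets only grow -/
  sub_snd : ∀ t ∈ st₀.map Prod.snd, t ∈ st.map Prod.snd
  /-- a claimed target is old or the image of a served source -/
  snd : ∀ t ∈ st.map Prod.snd, t ∈ st₀.map Prod.snd ∨ ∃ y ∈ st.map Prod.fst, t = f y
  /-- a newly served source has its image in the cell and unclaimed before the pass -/
  new : ∀ y ∈ st.map Prod.fst, y ∉ st₀.map Prod.fst → cell (f y) ∧ f y ∉ st₀.map Prod.snd

omit [DecidableEq α] in
/-- The invariant holds at the start. -/
theorem treeInv_refl (f : α → α) (cell : α → Prop) (st₀ : List (α × α)) :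
    TreeInv f cell st₀ st₀ :=
  ⟨fun _ h => h, fun _ h => h, fun _ h => Or.inl h, fun _ h h' => absurd h h'⟩

/-- One step of a tree pass keeps the invariant. -/
theorem treeInv_step {f : α → α} {cell : α → Prop} [DecidablePred cell]
    {st₀ st : List (α × α)} (h : TreeInv f cell st₀ st) (x : α) :
    TreeInv f cell st₀ (step st (x, treeCand f cell x)) := by
  unfold step
  split_ifs with hx
  · exact h
  · split
    · exact h
    · rename_i t ht
      obtain ⟨htc, htu⟩ := pick_some ht
      obtain ⟨rfl, hcell⟩ := mem_treeCand.mp htc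
      refine ⟨?_, ?_, ?_, ?_⟩
      · intro y hy
        exact List.mem_cons_of_mem _ (h.sub_fst y hy)
      · intro t' ht'
        exact List.mem_cons_of_mem _ (h.sub_snd t' ht')
      · intro t' ht'
        rw [List.map_cons, List.mem_cons] at ht'
        rcases ht' with rfl | ht'
        · exact Or.inr ⟨x, List.mem_cons_self .., rfl⟩
        · rcases h.snd t' ht' with h1 | ⟨y, hy, rfl⟩
          · exact Or.inl h1
          · exact Or.inr ⟨y, List.mem_cons_of_mem _ hy, rfl⟩
      · intro y hy hy₀
        rw [List.map_cons, List.mem_cons] at hy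
        rcases hy with rfl | hy
        · exact ⟨hcell, fun h0 => htu (h.sub_snd _ h0)⟩
        · exact h.new y hy hy₀

/-- A tree pass keeps the invariant. -/
theorem treeInv_foldl {f : α → α} {cell : α → Prop} [DecidablePred cell] (xs : List α)
    {st₀ st : List (α × α)} (h : TreeInv f cell st₀ st) :
    TreeInv f cell st₀ ((treeRequests f cell xs).foldl step st) := by
  induction xs generalizing st with
  | nil => exact h
  | cons y ys ih =>
    simp only [treeRequests, List.map_cons, List.foldl_cons]
    exact ih (treeInv_step h y)

/-- A source with its image in the cell and unclaimed before the pass is served by an INJECTIVE tree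
pass (whatever the order). -/
theorem mem_fst_foldl_treeRequests_of {f : α → α} (hf : Function.Injective f) {cell : α → Prop}
    [DecidablePred cell] (xs : List α) {st₀ st : List (α × α)} (h : TreeInv f cell st₀ st) {x : α}
    (hx : x ∈ xs) (hcell : cell (f x)) (hfree : f x ∉ st₀.map Prod.snd) :
    x ∈ ((treeRequests f cell xs).foldl step st).map Prod.fst := by
  induction xs generalizing st with
  | nil => exact absurd hx (List.not_mem_nil)
  | cons y ys ih =>
    simp only [treeRequests, List.map_cons, List.foldl_cons]
    rw [List.mem_cons] at hx
    by_cases hxy : x = y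
    · subst hxy
      -- after the step on `x`, `x` is served; it stays served
      refine mem_fst_foldl_of_mem _ ?_
      unfold step
      split_ifs with hxs
      · exact hxs
      · have hpick : pick (st.map Prod.snd) (treeCand f cell x) = some (f x) := by
          simp only [treeCand, if_pos hcell, pick]
          rw [if_neg]
          intro hmem
          rcases h.snd (f x) hmem with h1 | ⟨z, hz, hz'⟩
          · exact hfree h1
          · exact hxs (hf hz' ▸ hz)
        split
        · rename_i hnone
          rw [hpick] at hnone
          exact absurd hnone (by simp)
        · rename_i t ht
          rw [hpick] at ht
          obtain rfl := Option.some.inj ht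
          exact List.mem_cons_self ..
    · rcases hx with rfl | hx
      · exact absurd rfl hxy
      · exact ih (treeInv_step h y) hx

/-- **An injective tree pass is canonical**: starting from `st₀`, a source `x ∈ xs` is served after the
pass iff it was served before, or its image lies in the cell and was unclaimed before the pass —
independently of the order of the sources. -/
theorem mem_fst_foldl_treeRequests_iff {f : α → α} (hf : Function.Injective f) {cell : α → Prop}
    [DecidablePred cell] (xs : List α) (st₀ : List (α × α)) {x : α} (hx : x ∈ xs) :
    x ∈ ((treeRequests f cell xs).foldl step st₀).map Prod.fst ↔
      x ∈ st₀.map Prod.fst ∨ (cell (f x) ∧ f x ∉ st₀.map Prod.snd) := by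
  constructor
  · intro hserved
    by_cases h₀ : x ∈ st₀.map Prod.fst
    · exact Or.inl h₀
    · exact Or.inr ((treeInv_foldl xs (treeInv_refl f cell st₀)).new x hserved h₀)
  · rintro (h₀ | ⟨hcell, hfree⟩)
    · exact mem_fst_foldl_of_mem _ h₀
    · exact mem_fst_foldl_treeRequests_of hf xs (treeInv_refl f cell st₀) hx hcell hfree

end PassScheme

end PercRepro
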